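import Literature.AlgebraicGeometry.Motives.GoodReductionSpecialFibreProofs
import Mathlib.RingTheory.Flat.TorsionFree
import Mathlib.RingTheory.DiscreteValuationRing.Basic
import HarnessLib

/-!
# Generic fibres over a discrete valuation ring and the generic fibre of a Chow cover

Scheme-theoretic inputs for Zariski's connectedness theorem for smooth proper models over a discrete
valuation ring proved via a projective (Chow) cover
(`Literature/AlgebraicGeometry/Motives/GoodReductionZariskiProofs`). For a domain `R` with fraction
field `K`:

* `ZariskiChow.isLocalizationAway_of_irreducible`, `ZariskiChow.isOpenImmersion_specMap_algebraMap` —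
  for a discrete valuation ring, `K = R[1/ϖ]` for a uniformizer `ϖ`, so **`Spec K → Spec R` is an open
  immersion** (the generic point is open);
* `ZariskiChow.dense_range_fst`, `ZariskiChow.irreducibleSpace_of_genericFibre` — **the generic fibre
  of a universally open `f : X → Spec R` is dense** (a non-empty open of `Spec R` contains the generic
  point, `bot_mem_of_isOpen`), hence `X` is irreducible as soon as `X_K` is (EGA IV₂ 2.3.4-type
  statement; Hartshorne III Prop. 9.7 for flat families over a curve);
* `ZariskiChow.flat_of_isIntegral_of_surjective` — **an integral scheme surjective onto the spectrum of
  a principal ideal domain is flat over it** (Hartshorne III Prop. 9.7: flat ⟺ every associated point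
  maps to the generic point; here: the rings of functions of the non-empty affine opens are domains into
  which `R` injects by dominance, and torsion-free = flat over Bézout domains, Mathlib
  `Module.Flat.flat_iff_torsion_eq_bot_of_isBezout`, Stacks 0539);
* `ZariskiChow.exists_iso_preimage` — for `π : Z → X` an isomorphism over the open `U ⊆ X`, the
  induced morphism between the opens `p_Z⁻¹(π⁻¹U) ⊆ Z_K` and `p_X⁻¹(U) ⊆ X_K` of the generic fibres
  is an isomorphism (Mathlib `IsOpenImmersion.isPullback`, `IsOpenImmersion.lift`);
* `ZariskiChow.mem_range_of_isIntegralElem_chowCover` — **`K` is integrally closed in `Γ(Z_K, 𝒪)`**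
  for `Z` integral, `π : Z → X` an isomorphism over a non-empty open `U`, `f : X → Spec R` universally
  open with integral geometrically irreducible generic fibre and `Spec K → Spec R` an open immersion:
  an element of `Γ(Z_K, 𝒪)` integral over `K` restricts to a function on `p_X⁻¹(U)`, an open of `X_K`,
  integral over `K`, hence constant (Stacks Project, Tag 054Q, via the tree's
  `mem_range_of_isIntegralElem_of_geometricallyIrreducible`), and `Z_K` is integral. This is hypothesis
  `hK` of `Literature.AlgebraicGeometry.Motives.bijective_appTop_of_genericFibre` (`Γ(Z, 𝒪_Z) = R`,
  Stacks Project, Tag 0AY8, proof) for the Chow cover `Z → X → Spec R`.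

Everything is proved; no named facts. Mathlib searched (pin v4.32): `IsOpenImmersion.of_isLocalization`,
`IsDiscreteValuationRing.eq_unit_mul_pow_irreducible`, `Scheme.Pullback.range_fst`,
`HasRingHomProperty.of_iSup_eq_top`, `IsSchemeTheoreticallyDominant.of_isDominant`,
`Scheme.Hom.app_injective`, `IsOpenImmersion.isPullback`, `map_injective_of_isIntegral` (used); Mathlib
has flatness over Dedekind/valuation rings only module-theoretically (`Flat/TorsionFree`).

## References

* R. Hartshorne, *Algebraic Geometry*, GTM 52 (1977): III Prop. 9.7 (p. 257). [Hartshorne1977]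
* The Stacks Project, Tags 0539 (flat = torsion free over valuation/Bézout rings), 054Q (Varieties,
  Lemma 33.8.6), 0AY8 (More on Morphisms, Lemma 37.53.6, proof). [StacksProject]
-/

noncomputable section

open CategoryTheory CategoryTheory.Limits AlgebraicGeometry TopologicalSpace Opposite

universe u

namespace Literature.AlgebraicGeometry.Motives

namespace ZariskiChow

/-! ### The generic point of the spectrum of a discrete valuation ring is open -/

section DVR

variable (R K : Type u) [CommRing R] [IsDomain R] [IsDiscreteValuationRing R] [Field K] [Algebra R K]
  [IsFractionRing R K]

/-- The fraction field of a discrete valuation ring is the localization away from a uniformizer.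
[folklore] -/
theorem isLocalizationAway_of_irreducible {ϖ : R} (hϖ : Irreducible ϖ) : IsLocalization.Away ϖ K where
  map_units := by
    rintro ⟨_, n, rfl⟩
    exact IsUnit.mk0 _ (by
      rw [map_pow]
      exact pow_ne_zero _ (IsFractionRing.to_map_ne_zero_of_mem_nonZeroDivisors
        (mem_nonZeroDivisors_of_ne_zero hϖ.ne_zero)))
  surj := by
    intro z
    obtain ⟨a, b, hb, rfl⟩ := IsFractionRing.div_surjective (A := R) z
    have hb0 : (b : R) ≠ 0 := nonZeroDivisors.ne_zero hb
    obtain ⟨n, u, hu⟩ := IsDiscreteValuationRing.eq_unit_mul_pow_irreducible hb0 hϖ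
    refine ⟨⟨a * ↑u⁻¹, ⟨ϖ ^ n, n, rfl⟩⟩, ?_⟩
    have hbK : algebraMap R K b ≠ 0 := IsFractionRing.to_map_ne_zero_of_mem_nonZeroDivisors hb
    change algebraMap R K a / algebraMap R K b * algebraMap R K (ϖ ^ n) = algebraMap R K (a * ↑u⁻¹)
    rw [div_mul_eq_mul_div, div_eq_iff hbK, hu, map_mul, map_mul]
    have : algebraMap R K ↑u⁻¹ * algebraMap R K ↑u = 1 := by
      rw [← map_mul, Units.inv_mul, map_one]
    linear_combination (-(algebraMap R K a * algebraMap R K (ϖ ^ n))) * this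
  exists_of_eq := by
    intro x y h
    exact ⟨1, by rw [IsFractionRing.injective R K h]⟩

/-- **`Spec K → Spec R` is an open immersion for a discrete valuation ring `R` with fraction field
`K`** (its image is the generic point `D(ϖ)`). [folklore] -/
theorem isOpenImmersion_specMap_algebraMap :
    IsOpenImmersion (Spec.map (CommRingCat.ofHom (algebraMap R K))) := by
  obtain ⟨ϖ, hϖ⟩ := IsDiscreteValuationRing.exists_irreducible R
  haveI := isLocalizationAway_of_irreducible R K hϖ
  exact IsOpenImmersion.of_isLocalization ϖ

end DVR

/-! ### Density of the generic fibre and integrality -/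

section GenericFibre

variable {R K : Type u} [CommRing R] [IsDomain R] [Field K] [Algebra R K] [IsFractionRing R K]

/-- A non-empty open subset of `Spec R`, `R` a domain, contains the generic point `(0)`. [folklore] -/
theorem bot_mem_of_isOpen {O : Set (Spec (.of R))} (hO : IsOpen O) {x : Spec (.of R)} (hx : x ∈ O) :
    (⟨⊥, Ideal.isPrime_bot⟩ : PrimeSpectrum R) ∈ O := by
  have hspec : (⟨⊥, Ideal.isPrime_bot⟩ : PrimeSpectrum R) ⤳ x :=
    (PrimeSpectrum.le_iff_specializes _ _).mp bot_le
  exact hspec.mem_open hO hx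

/-- The image of `Spec K → Spec R` is the generic point. [folklore] -/
theorem range_specMap_algebraMap :
    Set.range (Spec.map (CommRingCat.ofHom (algebraMap R K))).base = {⟨⊥, Ideal.isPrime_bot⟩} := by
  ext x
  simp only [Set.mem_range, Set.mem_singleton_iff]
  constructor
  · rintro ⟨y, rfl⟩
    apply PrimeSpectrum.ext
    change Ideal.comap (algebraMap R K) y.asIdeal = ⊥
    have hy : y.asIdeal = ⊥ := by
      haveI := y.2
      exact Ideal.eq_bot_of_prime y.asIdeal
    rw [hy]
    exact Ideal.comap_bot_of_injective _ (IsFractionRing.injective R K)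
  · rintro rfl
    refine ⟨⟨⊥, Ideal.isPrime_bot⟩, PrimeSpectrum.ext ?_⟩
    change Ideal.comap (algebraMap R K) ⊥ = ⊥
    exact Ideal.comap_bot_of_injective _ (IsFractionRing.injective R K)

variable {X : Scheme.{u}} (f : X ⟶ Spec (.of R))

/-- **The generic fibre of a universally open morphism to `Spec R` is dense** (`R` a domain): the
image of a non-empty open is a non-empty open of `Spec R`, hence contains the generic point. [folklore] -/
theorem dense_range_fst [UniversallyOpen f] :
    Dense (Set.range (pullback.fst f (Spec.map (CommRingCat.ofHom (algebraMap R K)))).base) := by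
  rw [Scheme.Pullback.range_fst, range_specMap_algebraMap]
  refine dense_iff_inter_open.mpr fun O hO ⟨x, hx⟩ => ?_
  have himg : IsOpen (f.base '' O) := f.isOpenMap O hO
  have hbot := bot_mem_of_isOpen himg ⟨x, hx, rfl⟩
  obtain ⟨y, hy, hyx⟩ := hbot
  exact ⟨y, hy, by rw [Set.mem_preimage, hyx]; rfl⟩

/-- **A scheme universally open over a domain whose generic fibre is irreducible is irreducible.**
[folklore] -/
theorem irreducibleSpace_of_genericFibre [UniversallyOpen f]
    [IrreducibleSpace ↥(pullback f (Spec.map (CommRingCat.ofHom (algebraMap R K))))] : IrreducibleSpace X := by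
  have hirr : IsIrreducible (Set.range (pullback.fst f (Spec.map (CommRingCat.ofHom (algebraMap R K)))).base) := by
    rw [← Set.image_univ]
    exact (IrreducibleSpace.isIrreducible_univ _).image _ (Scheme.Hom.continuous _).continuousOn
  obtain ⟨hne, hpre⟩ := (dense_range_fst (K := K) f).closure_eq ▸ hirr.closure
  haveI : PreirreducibleSpace X := ⟨hpre⟩
  exact ⟨Set.nonempty_iff_univ_nonempty.mpr hne⟩

end GenericFibre

/-! ### Integral schemes over a discrete valuation ring are flat -/

section Flat

variable {R : Type u} [CommRing R] [IsDomain R] [IsPrincipalIdealRing R] {Z : Scheme.{u}} (g : Z ⟶ Spec (.of R))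

/-- Transport of injectivity of a restriction along an equality of opens. [folklore] -/
theorem injective_comp_map_of_eq {X : Scheme.{u}} {W W' V : X.Opens} (e : W = W') (h : W ≤ V) (h' : W' ≤ V)
    {S : Type*} (φ : S → Γ(X, V)) (H : Function.Injective ((X.presheaf.map (homOfLE h).op) ∘ φ)) :
    Function.Injective ((X.presheaf.map (homOfLE h').op) ∘ φ) := by
  subst e; exact H

/-- **An integral scheme surjective over the spectrum of a principal ideal domain (e.g. a discrete
valuation ring) is flat over it** (flat = torsion free over Bézout domains, Mathlib
`Module.Flat.flat_iff_torsion_eq_bot_of_isBezout`; the rings of functions of the non-empty affine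
opens of `Z` are domains into which `R` injects, `Z → Spec R` being dominant; Hartshorne III
Prop. 9.7). [cite: Hartshorne1977, III Prop. 9.7 p. 257] -/
theorem flat_of_isIntegral_of_surjective [IsIntegral Z] [Surjective g] : Flat g := by
  apply HasRingHomProperty.of_iSup_eq_top (P := @Flat) (fun V : Z.affineOpens => V)
    (iSup_affineOpens_eq_top Z)
  intro V
  -- the ring map `Γ(Spec R, ⊤) → Γ(Z, V)`
  set φ := (g.appLE ⊤ (V : Z.Opens) le_top).hom with hφ
  letI := φ.toAlgebra
  change Module.Flat Γ(Spec (.of R), ⊤) Γ(Z, V)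
  -- `Γ(Spec R, ⊤) ≅ R` is a Bézout domain
  let eR : R ≃+* Γ(Spec (.of R), ⊤) := (Scheme.ΓSpecIso (.of R)).symm.commRingCatIsoToRingEquiv
  haveI : IsDomain Γ(Spec (.of R), ⊤) := MulEquiv.isDomain R eR.symm.toMulEquiv
  haveI : IsPrincipalIdealRing Γ(Spec (.of R), ⊤) := IsPrincipalIdealRing.of_surjective eR.toRingHom eR.surjective
  rw [Module.Flat.flat_iff_torsion_eq_bot_of_isBezout, ← Submodule.isTorsionFree_iff_torsion_eq_bot]
  -- empty `V`: nothing to prove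
  rcases isEmpty_or_nonempty (V : Z.Opens) with hV | hV
  · have hbot : (V : Z.Opens) = ⊥ := by
      ext x
      exact ⟨fun hx => (hV.false ⟨x, hx⟩).elim, fun hx => hx.elim⟩
    haveI : Subsingleton Γ(Z, V) := CommRingCat.subsingleton_of_isTerminal (Z.sheaf.isTerminalOfEqEmpty hbot)
    infer_instance
  -- non-empty `V`: `Γ(Z, V)` is a domain and `φ` is injective (`V → Spec R` is dominant)
  haveI : IsDomain Γ(Z, V) := inferInstance
  have hinj : Function.Injective φ := by
    have hdense : Dense ((V : Z.Opens) : Set Z) := (V : Z.Opens).2.dense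
      (by obtain ⟨x⟩ := hV; exact ⟨x.1, x.2⟩)
    haveI : IsDominant (V : Z.Opens).ι := Opens.isDominant_ι hdense
    haveI : IsDominant ((V : Z.Opens).ι ≫ g) := inferInstance
    haveI : IsSchemeTheoreticallyDominant ((V : Z.Opens).ι ≫ g) :=
      IsSchemeTheoreticallyDominant.of_isDominant _
    haveI : IsAffine (V : Z.Opens) := V.2
    have h1 := ((V : Z.Opens).ι ≫ g).app_injective ⊤
    rw [Scheme.Hom.comp_app, Scheme.Opens.ι_app] at h1
    have e : (V : Z.Opens).ι ''ᵁ ((V : Z.Opens).ι ⁻¹ᵁ (g ⁻¹ᵁ ⊤)) = V := by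
      change (V : Z.Opens).ι ''ᵁ ⊤ = V
      exact Scheme.Opens.ι_image_top _
    exact injective_comp_map_of_eq e _ (le_top : (V : Z.Opens) ≤ g ⁻¹ᵁ ⊤) (g.app ⊤) h1
  haveI : FaithfulSMul Γ(Spec (.of R), ⊤) Γ(Z, V) := (faithfulSMul_iff_algebraMap_injective _ _).mpr hinj
  infer_instance

end Flat

/-! ### The generic fibre of a Chow cover -/

section ChowCover

variable {R K : Type u} [CommRing R] [IsDomain R] [Field K] [Algebra R K] [IsFractionRing R K]
  {X Z : Scheme.{u}} (f : X ⟶ Spec (.of R)) (π : Z ⟶ X) (U : X.Opens) [IsIso (π ∣_ U)]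

/-- A point of the Chow cover inside `π⁻¹(U)` over the generic point (`U ≠ ∅`, `f` universally
open). [folklore] -/
theorem exists_mem_preimage_over_generic [UniversallyOpen f] (hU : (U : Set X).Nonempty) :
    ∃ z : Z, z ∈ π ⁻¹ᵁ U ∧ (π ≫ f).base z ∈ Set.range ((Spec.map (CommRingCat.ofHom (algebraMap R K)))).base := by
  obtain ⟨x, hxU, hx⟩ := (dense_range_fst (K := K) f).inter_open_nonempty U U.2 hU
  rw [Scheme.Pullback.range_fst] at hx
  set z : ↥(π ⁻¹ᵁ U) := (inv (π ∣_ U)).base ⟨x, hxU⟩ with hz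
  have hπz : π.base z.1 = x := by
    have h1 := morphismRestrict_base_coe π U z
    have h2 : (π ∣_ U).base ((inv (π ∣_ U)).base ⟨x, hxU⟩) = ⟨x, hxU⟩ := by
      change ((inv (π ∣_ U)) ≫ (π ∣_ U)).base ⟨x, hxU⟩ = ⟨x, hxU⟩
      rw [IsIso.inv_hom_id]; rfl
    rw [hz, ← h1, h2]
  refine ⟨z.1, z.2, ?_⟩
  change f.base (π.base z.1) ∈ _
  rw [hπz]
  exact hx

/-- The open `p_Z⁻¹(π⁻¹ U)` of the generic fibre `Z_K` of the Chow cover is non-empty. [folklore] -/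
theorem nonempty_preimage_preimage [UniversallyOpen f] (hU : (U : Set X).Nonempty) :
    Nonempty ↥((pullback.fst (π ≫ f) (Spec.map (CommRingCat.ofHom (algebraMap R K)))) ⁻¹ᵁ (π ⁻¹ᵁ U)) := by
  obtain ⟨z, hz, hzK⟩ := exists_mem_preimage_over_generic (K := K) f π U hU
  have : z ∈ Set.range (pullback.fst (π ≫ f) (Spec.map (CommRingCat.ofHom (algebraMap R K)))).base := by
    rw [Scheme.Pullback.range_fst]; exact hzK
  obtain ⟨w, rfl⟩ := this
  exact ⟨⟨w, hz⟩⟩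

/-- The range of a restricted morphism `f ∣_ U`. [folklore] -/
theorem range_morphismRestrict {X Y : Scheme.{u}} (f : X ⟶ Y) (U : Y.Opens) :
    Set.range (f ∣_ U).base = (Subtype.val : U → Y) ⁻¹' Set.range f.base := by
  ext y
  constructor
  · rintro ⟨x, rfl⟩
    exact ⟨x.1, (morphismRestrict_base_coe f U x).symm⟩
  · rintro ⟨x, hx⟩
    have hxU : x ∈ f ⁻¹ᵁ U := by change f.base x ∈ U; rw [hx]; exact y.2
    exact ⟨⟨x, hxU⟩, Subtype.ext ((morphismRestrict_base_coe f U ⟨x, hxU⟩).trans hx)⟩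

variable [IsOpenImmersion (Spec.map (CommRingCat.ofHom (algebraMap R K)))]

omit [IsDomain R] [IsFractionRing R K] in
/-- **The Chow cover is an isomorphism over `U` after passage to the generic fibre**: the morphism
`p_Z⁻¹(π⁻¹U) → p_X⁻¹(U)` induced between the opens of the generic fibres `Z_K`, `X_K` is an
isomorphism (a base change of `π⁻¹(U) ≅ U` along the open immersion `p_X⁻¹(U) → U`). We record it as
the existence of an isomorphism compatible with the inclusions. [folklore] -/
theorem exists_iso_preimage :
    ∃ gW : ((pullback.fst (π ≫ f) (Spec.map (CommRingCat.ofHom (algebraMap R K)))) ⁻¹ᵁ (π ⁻¹ᵁ U)).toScheme ⟶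
        ((pullback.fst f (Spec.map (CommRingCat.ofHom (algebraMap R K)))) ⁻¹ᵁ U).toScheme,
      IsIso gW ∧ gW ≫ (pullback.fst f (Spec.map (CommRingCat.ofHom (algebraMap R K))) ∣_ U) =
        (pullback.fst (π ≫ f) (Spec.map (CommRingCat.ofHom (algebraMap R K))) ∣_ (π ⁻¹ᵁ U)) ≫ (π ∣_ U) := by
  set pZ := pullback.fst (π ≫ f) (Spec.map (CommRingCat.ofHom (algebraMap R K))) with hpZ
  set pX := pullback.fst f (Spec.map (CommRingCat.ofHom (algebraMap R K))) with hpX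
  set iU := pZ ∣_ (π ⁻¹ᵁ U)
  set iV := pX ∣_ U
  set e := π ∣_ U
  -- points of `Z` over the generic point map into the range of `p_X`
  have key : ∀ z : Z, z ∈ Set.range pZ.base ↔ π.base z ∈ Set.range pX.base := by
    intro z
    rw [hpZ, hpX, Scheme.Pullback.range_fst, Scheme.Pullback.range_fst]
    rfl
  have hrange : Set.range (iU ≫ e).base ⊆ Set.range iV.base := by
    rintro _ ⟨w, rfl⟩
    rw [range_morphismRestrict]
    change (e.base (iU.base w)).1 ∈ Set.range pX.base
    rw [morphismRestrict_base_coe, ← key, morphismRestrict_base_coe]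
    exact ⟨w.1, rfl⟩
  let gW := IsOpenImmersion.lift iV (iU ≫ e) hrange
  have H : iU ≫ e = gW ≫ iV := (IsOpenImmersion.lift_fac iV (iU ≫ e) hrange).symm
  have H' : e ⁻¹ᵁ iV.opensRange = iU.opensRange := by
    ext z
    change e.base z ∈ Set.range iV.base ↔ z ∈ Set.range iU.base
    rw [range_morphismRestrict, range_morphismRestrict]
    change (e.base z).1 ∈ Set.range pX.base ↔ z.1 ∈ Set.range pZ.base
    rw [morphismRestrict_base_coe, ← key]
  have hpb : IsPullback gW iU iV e := IsOpenImmersion.isPullback gW iU iV e H H'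
  exact ⟨gW, hpb.isIso_fst_of_isIso, H.symm⟩

variable [UniversallyOpen f] [IsIntegral Z] [PerfectField K]
  [IsIntegral (pullback f (Spec.map (CommRingCat.ofHom (algebraMap R K))))]
  [GeometricallyIrreducible (pullback.snd f (Spec.map (CommRingCat.ofHom (algebraMap R K))))]

/-- **`K` is integrally closed in the ring of functions of the generic fibre of the Chow cover.**
Let `R` be a domain with fraction field `K` such that `Spec K → Spec R` is an open immersion (e.g. a
discrete valuation ring), `f : X → Spec R` universally open with integral, geometrically irreducible
generic fibre `X_K`, `Z` integral and `π : Z → X` an isomorphism over a non-empty open `U ⊆ X`. Then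
every element of `Γ(Z_K, 𝒪)` integral over `K` is a constant: its restriction to the non-empty open
`p_Z⁻¹(π⁻¹U) ≅ p_X⁻¹(U)` is a function on an open of `X_K` integral over `K`, hence constant
(`mem_range_of_isIntegralElem_of_geometricallyIrreducible`, Stacks Project, Tag 054Q), and `Z_K` is
integral. [folklore] -/
theorem mem_range_of_isIntegralElem_chowCover (hU : (U : Set X).Nonempty)
    (b : Γ(pullback (π ≫ f) (Spec.map (CommRingCat.ofHom (algebraMap R K))), ⊤))
    (hb : ((Scheme.ΓSpecIso (.of K)).inv ≫
      (pullback.snd (π ≫ f) (Spec.map (CommRingCat.ofHom (algebraMap R K)))).appTop).hom.IsIntegralElem b) :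
    b ∈ ((Scheme.ΓSpecIso (.of K)).inv ≫
      (pullback.snd (π ≫ f) (Spec.map (CommRingCat.ofHom (algebraMap R K)))).appTop).hom.range := by
  set pZ := pullback.fst (π ≫ f) (Spec.map (CommRingCat.ofHom (algebraMap R K))) with hpZ
  set sZ := pullback.snd (π ≫ f) (Spec.map (CommRingCat.ofHom (algebraMap R K))) with hsZ
  set pX := pullback.fst f (Spec.map (CommRingCat.ofHom (algebraMap R K))) with hpX
  set sX := pullback.snd f (Spec.map (CommRingCat.ofHom (algebraMap R K))) with hsX
  set W : (pullback (π ≫ f) (Spec.map (CommRingCat.ofHom (algebraMap R K)))).Opens := pZ ⁻¹ᵁ (π ⁻¹ᵁ U) with hW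
  set V : (pullback f (Spec.map (CommRingCat.ofHom (algebraMap R K)))).Opens := pX ⁻¹ᵁ U with hV
  set eK := Scheme.ΓSpecIso (.of K)
  -- non-emptiness and integrality
  have hWne : Nonempty ↥W := nonempty_preimage_preimage (K := K) f π U hU
  obtain ⟨w₀⟩ := hWne
  haveI : Nonempty W.toScheme := ⟨w₀⟩
  haveI : Nonempty ↥(pullback (π ≫ f) (Spec.map (CommRingCat.ofHom (algebraMap R K)))) := ⟨w₀.1⟩
  haveI : IsIntegral (pullback (π ≫ f) (Spec.map (CommRingCat.ofHom (algebraMap R K)))) :=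
    isIntegral_of_isOpenImmersion pZ
  obtain ⟨gW, hgW, hcomm⟩ := exists_iso_preimage (K := K) f π U
  haveI := hgW
  haveI : Nonempty V.toScheme := ⟨gW.base w₀⟩
  haveI : IsIntegral V.toScheme := isIntegral_of_isOpenImmersion V.ι
  haveI : Surjective (V.ι ≫ sX) := ⟨fun y => ⟨Classical.arbitrary _, Subsingleton.elim _ _⟩⟩
  haveI : GeometricallyIrreducible (V.ι ≫ sX) := inferInstance
  -- the structure maps to `Spec K` are compatible with `gW` (cancel the monomorphism `Spec K → Spec R`)
  have hK_comm : gW ≫ V.ι ≫ sX = W.ι ≫ sZ := by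
    rw [← cancel_mono (Spec.map (CommRingCat.ofHom (algebraMap R K))), Category.assoc, Category.assoc,
      Category.assoc, ← pullback.condition, ← pullback.condition]
    -- `gW ≫ V.ι ≫ pX ≫ f = W.ι ≫ pZ ≫ π ≫ f`
    have h1 : V.ι ≫ pX = (pX ∣_ U) ≫ U.ι := (morphismRestrict_ι pX U).symm
    have h2 : W.ι ≫ pZ = (pZ ∣_ (π ⁻¹ᵁ U)) ≫ (π ⁻¹ᵁ U).ι := (morphismRestrict_ι pZ (π ⁻¹ᵁ U)).symm
    rw [reassoc_of% h1, reassoc_of% hcomm, reassoc_of% h2, ← morphismRestrict_ι_assoc π U]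
  -- the `K`-structures on the rings of functions
  set ψZ := (eK.inv ≫ sZ.appTop).hom with hψZ
  set ψW := (eK.inv ≫ (W.ι ≫ sZ).appTop).hom with hψW
  set ψV := (eK.inv ≫ (V.ι ≫ sX).appTop).hom with hψV
  have hψW' : ψW = W.ι.appTop.hom.comp ψZ := by
    rw [hψW, hψZ, Scheme.Hom.comp_appTop]; rfl
  have hψWV : ψW = gW.appTop.hom.comp ψV := by
    rw [hψW, hψV, ← hK_comm, Scheme.Hom.comp_appTop]; rfl
  have hψVW : ψV = (inv gW).appTop.hom.comp ψW := by
    rw [hψWV]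
    ext c
    change _ = (gW.appTop ≫ (inv gW).appTop) (ψV c)
    rw [← Scheme.Hom.comp_appTop, IsIso.inv_hom_id, Scheme.Hom.id_appTop]
    rfl
  -- transport `b` to `V`
  set b₁ := W.ι.appTop b with hb₁
  set b₂ := (inv gW).appTop b₁ with hb₂
  have hb₂' : ψV.IsIntegralElem b₂ := by
    rw [hψVW, hψW']
    have := (hb.map W.ι.appTop.hom).map (inv gW).appTop.hom
    rwa [← hb₁, ← hb₂] at this
  obtain ⟨c, hc⟩ := mem_range_of_isIntegralElem_of_geometricallyIrreducible (V.ι ≫ sX) b₂ hb₂'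
  -- hence `b₁ = ψW c` and `b = ψZ c`
  have hb₁c : b₁ = ψW c := by
    have : gW.appTop b₂ = b₁ := by
      rw [hb₂]
      change ((inv gW).appTop ≫ gW.appTop) b₁ = b₁
      rw [← Scheme.Hom.comp_appTop, IsIso.hom_inv_id, Scheme.Hom.id_appTop]
      rfl
    rw [← this, ← hc, hψWV]
    rfl
  refine ⟨c, ?_⟩
  have hinj : Function.Injective W.ι.appTop := by
    rw [Scheme.Opens.ι_appTop]
    have hne : Nonempty ↥(W.ι ''ᵁ ⊤) := ⟨⟨w₀.1, by rw [Scheme.Opens.ι_image_top]; exact w₀.2⟩⟩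
    exact map_injective_of_isIntegral (H := hne) (pullback (π ≫ f) (Spec.map (CommRingCat.ofHom (algebraMap R K)))) _
  apply hinj
  change W.ι.appTop (ψZ c) = b₁
  rw [hb₁c, hψW']
  rfl

end ChowCover

end ZariskiChow

end Literature.AlgebraicGeometry.Motives
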